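import Literature.Probability.RandomPlanarGeometry.USTPeanoSetting
import Literature.Probability.RandomPlanarGeometry.SLETraceEightAssembly
import HarnessLib

/-!
# [LSW04] Thm. 4.4 for the UST Peano curve as a named fact, and Thm. 4.7 from it and Prop. 4.5

G. F. Lawler, O. Schramm, W. Werner, *Conformal invariance of planar loop-erased random walks and
uniform spanning trees*, Ann. Probab. **32** (2004) 939–995 (**[LSW04]**). The proof of Thm. 4.7
("chordal SLE₈ traces a path" = `Literature.Probability.RandomPlanarGeometry.hasSLETrace_eight`),
p. 981, reads: "Let `W(t) = W_R(t)` denote the chordal Loewner driving process for `γ̂`. Fix a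
sequence `Rₙ → ∞`. First, note that the family of laws of `γ̂` is tight, because of
Proposition 4.5 and the Arzelà–Ascoli theorem. Also, Theorem 4.4 implies that the law of `W`
converges weakly to the law of `B(8t)`. Hence …" — everything after "Hence" (Prokhorov, the
chordal Lemma 3.14, identification of the limit) is PROVED in the tree and assembled in
`SLETraceEightAssembly.lean`. In the setting of `USTPeanoSetting.lean` this file vendors the
driving-process input and the two deterministic set-up facts LSW use silently as named facts,
takes Prop. 4.5 in its printed shape as an explicit hypothesis, and PROVES `hasSLETrace_eight`
from them given one family of grid approximations of a smooth domain (`hasSLETrace_eight_of_LSW`):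

* `USTPeano.nonempty_peanoPath` (§4.1: Peano paths exist — the bijection with spanning trees);
* `USTPeano.exists_capacityImage` (§2.1 / Thm. 4.4 set-up: the capacity parametrisation of
  `φ ∘ γ` and its continuous driving function exist — half-plane capacity and Loewner's theorem for
  simple curves, not in the tree);
* Prop. 4.5 as printed (the event `sup{|γ̂(t₂) - γ̂(t₁)| : t₁, t₂ ≤ t̄, |t₂ - t₁| ≤ δ} > ε`
  written as `∃ t₁ t₂ …`) is NOT a named fact of its own: it is the explicit hypothesis `h45` of
  `hasSLETrace_eight_of_LSW` (D-0026: an XL published estimate — its proof is Thm. 4.4, Lemma 4.6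
  and Schramm (2000), Thms. 10.7, 11.1(ii) — whose only use is this glue stays part of the proof
  obligation of `hasSLETrace_eight` instead of being vendored and seated separately; the former
  named fact `USTPeano.prop45`, p20758, was merged back here);
* `USTPeano.drivingProcess_tendsto` (p. 981: "Theorem 4.4 implies that the law of `W` converges
  weakly to the law of `B(8t)`" along `Rₙ → ∞`, weak convergence spelled with bounded continuous
  test functions; Thm. 4.4 itself quantifies over all `D ∈ 𝔇*` with hypotheses on the inner radius
  and on a harmonic measure — a notion the tree lacks — and LSW use it only through this sentence);
* `hasSLETrace_eight_of_LSW` — PROVED.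

What then remains of `hasSLETrace_eight`: discharging the three facts (the deterministic §4.1 and
§2.1 — done meanwhile in `LSW2004USTPeanoExistence.lean`, `LSW2004USTProofs.lean` — and Thm. 4.4),
proving Prop. 4.5 (the UST theory of [LSW04] §4 with Schramm (2000)), and constructing one
approximating family (elementary lattice geometry; `DiscApproximation.lean`).
-/

noncomputable section

open Set Function Filter MeasureTheory Complex
open _root_.Topology
open UpperHalfPlane (upperHalfPlaneSet)
open scoped NNReal ENNReal unitInterval BoundedContinuousFunction

namespace Literature.Probability.RandomPlanarGeometry

open scoped PathBorel

namespace USTPeano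

/-! ### The named facts -/

/-- **[LSW04] §4.1: every `D ∈ 𝔇*` has a UST Peano path.** Pp. 971–972: "`H` is connected …
there is at least one spanning tree `T` of `H` which contains `α` … `T ↦ γ(T)` is a bijection
between the set of spanning trees of `H` containing `α` and the set of oriented paths in `G⃗ ∩ D`
from `a` to `b` containing `V_P`", where `γ(T)` = "the set of all edges of `G⃗` which do not
intersect `T ∪ T†` and which have at least one endpoint in `D`" is shown to be such a path; in
particular the set of Peano paths (`USTPeano.PeanoPath`) is nonempty, so that `ustLaw D` is a
probability measure. (Discrete planar topology; not proved here.) [cite: LawlerSchrammWerner2004, §4.1] -/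
def nonempty_peanoPath : Prop :=
  ∀ Δ : Domain, Nonempty (PeanoPath Δ)

/-- **[LSW04] §2.1 + Thm. 4.4 set-up: the capacity parametrisation and the driving process
exist.** §2.1, pp. 946–947: "one can encode continuous simple curves `η` from `0` to `∞` in the
closed upper half plane `ℍ̄` via a variant of Loewner's equation. … one can reparametrize `η` in
such a way that `a(t) = 2t` … This parametrization of `η` is called the parametrization by
capacity from infinity. … `∂ₜ gₜ(z) = 2/(gₜ(z) - W(t))`, where the driving function `W` is again
defined by `W(t) := gₜ(η(t))`. As above, `η` is determined by `W`"; applied in Thm. 4.4 (p. 976)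
to `η = φ ∘ γ` for `D ∈ 𝔇*`, `γ` its UST Peano path and `φ` the normalised map: for every Peano
path of every `D ∋ 0` and every normalised `φ` there are `γ̂`, `W` with
`IsCapacityImage D φ γ γ̂ W`. (Deterministic: half-plane capacity of simple curves and Loewner's
theorem; Lawler (2005), §4.1.) [cite: LawlerSchrammWerner2004, §2.1] -/
def exists_capacityImage : Prop :=
  ∀ (Δ : Domain), (0 : ℂ) ∈ Δ.carrier → ∀ (φ : ConformalEquiv upperHalfPlaneSet Δ.carrier),
    Δ.IsLSWMap φ → ∀ γ : PeanoPath Δ, ∃ (γhat : C(ℝ≥0, ℂ)) (W : C(ℝ≥0, ℝ)),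
      IsCapacityImage Δ φ γ γhat W

/-- **[LSW04], proof of Thms. 4.7/4.8 (p. 981): "Theorem 4.4 implies that the law of `W`
converges weakly to the law of `B(8t)`."** Setting of Thm. 4.8 / §4.3: `D ∋ 0` with `C¹` boundary,
`a ≠ b`, "for `R > 0` let `(D^R, α^R, β^R)` be an approximation of `(RD, Rα, Rβ)` as described in
Section 4.3", `γ = γ^R` the UST Peano curve in `D^R`, `φ_R : D^R → ℍ` normalised, `γ̂ := φ_R ∘ γ`
by capacity, `W = W_R` its driving process, "Fix a sequence `Rₙ → ∞`". Rendered along an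
arbitrary sequence of approximations `Δₙ` at scales `Rₙ → ∞` (all of them having Peano paths, cf.
`nonempty_peanoPath`), universally over the normalised maps and capacity images, with weak
convergence on `C([0, ∞), ℝ)` (locally uniform topology, p. 981) spelled out on bounded
continuous test functions, and `B` the canonical Brownian motion (`brownianTimeEight`). Theorem
4.4 itself (p. 976) is the coupling statement "for all `D ∈ 𝔇*` with `rad₀(D) > r₁` and
`ℌ_D(0, α) ∈ [ε₁, 1 - ε₁]` … `P[sup_{[0,t̄]} |W(t) - B(8t)| > ε₂] < ε₃`"; LSW use it through this
consequence (the inner radius of `D^R` tends to `∞` and the harmonic measure of `α^R` from `0`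
stays away from `0, 1`). Depends on Props. 4.2, 4.3, Skorokhod embedding, Koebe distortion.
[cite: LawlerSchrammWerner2004, Thm. 4.4] -/
def drivingProcess_tendsto : Prop :=
  ∀ (D : SmoothDomain) (R : ℕ → ℝ) (Δ : ℕ → Domain), Tendsto R atTop atTop →
    (∀ n, IsApproximation D (R n) (Δ n)) → (∀ n, Nonempty (PeanoPath (Δ n))) →
      ∀ (φ : ∀ n, ConformalEquiv upperHalfPlaneSet (Δ n).carrier)
        (Γ : ∀ n, PeanoPath (Δ n) → C(ℝ≥0, ℂ)) (W : ∀ n, PeanoPath (Δ n) → C(ℝ≥0, ℝ)),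
        (∀ n, (Δ n).IsLSWMap (φ n) ∧ ∀ γ, IsCapacityImage (Δ n) (φ n) γ (Γ n γ) (W n γ)) →
          ∀ f : C(ℝ≥0, ℝ) →ᵇ ℝ,
            Tendsto (fun n ↦ ∫ γ, f (W n γ) ∂ustLaw (Δ n)) atTop
              (𝓝 (∫ ω, f (brownianTimeEight ω) ∂Process.preWienerMeasure))

/-! ### [LSW04] Thm. 4.7 from the facts -/

/-- The law of `t ↦ B(8t)` for the canonical Brownian motion is the law of the SLE₈ driving path
`√8 B` (`map_timeScaledPath_eq_map_drivingPath`). [LSW04] Thm. 4.7 ("driven by `B(8t)`").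
[cite: LawlerSchrammWerner2004, Thm. 4.7] -/
theorem map_brownianTimeEight_eq :
    Process.preWienerMeasure.map brownianTimeEight =
      Process.preWienerMeasure.map (drivingPath 8) :=
  map_timeScaledPath_eq_map_drivingPath (κ := 8) (by norm_num)
    (Process.isBrownianReal_brownian exists_isBrownianReal_measurable_continuous_holds')
    Process.continuous_brownian Process.measurable_brownian

/-- **[LSW04] Thm. 4.7 (SLE₈ is generated by a curve) from the UST facts and Prop. 4.5.** Given a
smooth domain `D` and grid approximations `Δₙ` of `D` at scales `Rₙ → ∞` (§4.3), the facts
`nonempty_peanoPath` (§4.1), `exists_capacityImage` (§2.1) and `drivingProcess_tendsto` (Thm. 4.4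
via p. 981) together with the hypothesis `h45` = **[LSW04] Proposition 4.5 (Uniform continuity
estimate)**, p. 977, in the setting of §4.3 (`D`, `a ≠ b`, `α_D`, `β_D`, approximations `D^R`,
`γ = γ^R` the UST Peano path in `D^R`, `φ_R` the normalised map, `γ̂ := φ_R ∘ γ` parametrised by
capacity): "For every `ε > 0` and `t̄ > 0` there are some positive `R₀ = R₀(D, t̄, ε)` and
`δ = δ(D, t̄, ε)` such that for all `R > R₀`,
`P[sup{|γ̂(t₂) - γ̂(t₁)| : t₁, t₂ ∈ [0, t̄], |t₂ - t₁| ≤ δ} > ε] < ε`" — rendered with `R₀`, `δ`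
depending on `(D, t̄, ε)` only (with `a`, `b`, `C` fixed, i.e. the bound holds for every
approximation `D^R` at every scale `R > R₀`, the printed strength), the event `sup{…} > ε`
written as `∃ t₁ t₂ ≤ t̄, |t₂ - t₁| ≤ δ, |γ̂(t₂) - γ̂(t₁)| > ε` (the same event), `P = ustLaw D^R`,
and universally over the normalised `φ_R` and the capacity images `γ̂` (which are unique); its
printed proof rests on Thm. 4.4, Lemma 4.6 and Schramm (2000), Thms. 10.7, 11.1(ii), an XL theory,
so under D-0026 it is kept as a hypothesis of this glue (part of the proof obligation of
`hasSLETrace_eight`) and not vendored as a named fact — imply `hasSLETrace_eight`.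
Proof = p. 981: for each `n` choose the normalised map `φₙ` (`Domain.exists_isLSWMap`) and the
capacity images `(γ̂, W)` of the Peano paths; on the finite probability spaces
`(PeanoPath Δₙ, ustLaw)` these are random elements of `C([0,∞), ℂ) × C([0,∞), ℝ)` with generated
Loewner chains; Prop. 4.5 gives the modulus bound of `isTightMeasureSet_of_prop45_shape`, the
driving convergence gives `TendstoInDistribution` to the law of `√8 B` (test functions,
`map_brownianTimeEight_eq`), and `hasSLETrace_of_tendstoInDistribution` (Prokhorov + Lemma 3.14 +
identification, all proved) concludes. [cite: LawlerSchrammWerner2004, Thm. 4.7] -/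
theorem hasSLETrace_eight_of_LSW (D : SmoothDomain) (R : ℕ → ℝ) (Δ : ℕ → Domain)
    (hR : Tendsto R atTop atTop) (hΔ : ∀ n, IsApproximation D (R n) (Δ n))
    (h41 : nonempty_peanoPath) (hcap : exists_capacityImage)
    (h45 : ∀ (D : SmoothDomain) (ε t : ℝ), 0 < ε → 0 < t →
      ∃ R₀ δ : ℝ, 0 < δ ∧ ∀ (R : ℝ) (Δ : Domain), R₀ < R → IsApproximation D R Δ →
        ∀ (φ : ConformalEquiv upperHalfPlaneSet Δ.carrier), Δ.IsLSWMap φ →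
          ∀ (Γ : PeanoPath Δ → C(ℝ≥0, ℂ)) (W : PeanoPath Δ → C(ℝ≥0, ℝ)),
            (∀ γ, IsCapacityImage Δ φ γ (Γ γ) (W γ)) →
              ustLaw Δ {γ | ∃ t₁ t₂ : ℝ≥0, (t₁ : ℝ) ≤ t ∧ (t₂ : ℝ) ≤ t ∧
                dist t₁ t₂ ≤ δ ∧ ε < dist (Γ γ t₁) (Γ γ t₂)} < ENNReal.ofReal ε)
    (h44 : drivingProcess_tendsto) : hasSLETrace_eight := by
  classical
  haveI : Fact Process.isProjectiveLimit_preWienerMeasure := ⟨isProjectiveLimit_preWienerMeasure_holds'⟩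
  haveI hne : ∀ n, Nonempty (PeanoPath (Δ n)) := fun n ↦ h41 (Δ n)
  haveI : ∀ n, IsProbabilityMeasure (ustLaw (Δ n)) := fun n ↦ inferInstance
  -- the normalised maps and the capacity images
  have h0 : ∀ n, (0 : ℂ) ∈ (Δ n).carrier := fun n ↦ (hΔ n).2.2
  choose φ hφ using fun n ↦ (Δ n).exists_isLSWMap (h0 n)
  choose Γ W hΓW using fun n (γ : PeanoPath (Δ n)) ↦ hcap (Δ n) (h0 n) (φ n) (hφ n) γ
  -- the inputs of `hasSLETrace_of_tendstoInDistribution`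
  have hΓm : ∀ n, AEMeasurable (Γ n) (ustLaw (Δ n)) := fun n ↦
    (Measurable.of_discrete).aemeasurable
  have hWm : ∀ n, AEMeasurable (W n) (ustLaw (Δ n)) := fun n ↦
    (Measurable.of_discrete).aemeasurable
  have hgen : ∀ n, ∀ᵐ γ ∂ustLaw (Δ n), Loewner.IsGeneratedByCurve (W n γ) (Γ n γ) := fun n ↦
    ae_of_all _ fun γ ↦ (hΓW n γ).isGeneratedByCurve
  have hzero : ∀ n γ, Γ n γ 0 = 0 := fun n γ ↦ (hΓW n γ).apply_zero
  -- Prop. 4.5 ⇒ the modulus bound along the sequence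
  have h45' : ∀ (t ε : ℝ), 0 < ε → ∃ δ : ℝ, 0 < δ ∧ ∀ᶠ n in atTop,
      ustLaw (Δ n) {γ | ∃ s s' : ℝ≥0, (s : ℝ) ≤ t ∧ (s' : ℝ) ≤ t ∧ dist s s' ≤ δ ∧
        ε ≤ dist (Γ n γ s) (Γ n γ s')} < ENNReal.ofReal ε := by
    intro t ε hε
    rcases le_or_gt t 0 with ht | ht
    · -- degenerate horizon: the event is empty
      refine ⟨1, one_pos, Eventually.of_forall fun n ↦ ?_⟩
      have : {γ : PeanoPath (Δ n) | ∃ s s' : ℝ≥0, (s : ℝ) ≤ t ∧ (s' : ℝ) ≤ t ∧ dist s s' ≤ 1 ∧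
          ε ≤ dist (Γ n γ s) (Γ n γ s')} = ∅ := by
        ext γ
        simp only [mem_setOf_eq, mem_empty_iff_false, iff_false, not_exists, not_and, not_le]
        intro s s' hs hs' _
        have hs0 : (s : ℝ) = 0 := le_antisymm (hs.trans ht) s.2
        have hs0' : (s' : ℝ) = 0 := le_antisymm (hs'.trans ht) s'.2
        have : s = s' := by ext; rw [hs0, hs0']
        rw [this, dist_self]
        exact hε
      rw [this, measure_empty]
      exact ENNReal.ofReal_pos.2 hε
    obtain ⟨R₀, δ, hδ, H⟩ := h45 D (ε / 2) t (half_pos hε) ht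
    refine ⟨δ, hδ, ?_⟩
    filter_upwards [hR.eventually_gt_atTop R₀] with n hn
    have key := H (R n) (Δ n) hn (hΔ n) (φ n) (hφ n) (Γ n) (W n) (hΓW n)
    refine lt_of_le_of_lt (measure_mono ?_) (key.trans_le (ENNReal.ofReal_le_ofReal (by linarith)))
    rintro γ ⟨s, s', hs, hs', hss', hd⟩
    exact ⟨s, s', hs, hs', hss', by linarith⟩
  -- p. 981 ⇒ convergence in distribution of the driving functions to `√8 B`
  have hlaw : TendstoInDistribution W atTop (drivingPath 8) (fun n ↦ ustLaw (Δ n))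
      Process.preWienerMeasure := by
    refine ⟨hWm, (measurable_drivingPath 8).aemeasurable, ?_⟩
    rw [ProbabilityMeasure.tendsto_iff_forall_integral_tendsto]
    intro f
    have key := h44 D R Δ hR hΔ hne φ Γ W (fun n ↦ ⟨hφ n, hΓW n⟩) f
    have h1 : ∀ n, ∫ x, f x ∂((ustLaw (Δ n)).map (W n)) = ∫ γ, f (W n γ) ∂ustLaw (Δ n) := fun n ↦
      integral_map (hWm n) f.continuous.aestronglyMeasurable
    have h2 : ∫ x, f x ∂(Process.preWienerMeasure.map (drivingPath 8)) =
        ∫ ω, f (brownianTimeEight ω) ∂Process.preWienerMeasure := by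
      rw [← map_brownianTimeEight_eq,
        integral_map measurable_brownianTimeEight.aemeasurable f.continuous.aestronglyMeasurable]
    simp only [ProbabilityMeasure.coe_mk, h1, h2]
    exact key
  exact hasSLETrace_of_tendstoInDistribution hΓm hgen (isTightMeasureSet_of_prop45_shape hΓm hzero h45')
    hlaw

end USTPeano

end Literature.Probability.RandomPlanarGeometry

/-! ### [LSW04] Thm. 4.4 in its printed coupling shape implies the as-used form -/

namespace Literature.Probability.RandomPlanarGeometry

open scoped PathBorel

namespace USTPeano

/-- **The printed shape of [LSW04] Thm. 4.4 along approximating sequences implies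
`drivingProcess_tendsto`.** Thm. 4.4 (p. 976) concludes "there is a coupling of standard Brownian
motion `B : [0, ∞) → ℝ` and `W` such that `P[sup{|W(t) - B(8t)| : t ∈ [0, t̄]} > ε₂] < ε₃`", for
every `D ∈ 𝔇*` of large inner radius whose harmonic measure `ℌ_D(0, α)` is bounded away from `0`
and `1`; along the approximations `D^{Rₙ}`, `Rₙ → ∞`, of a smooth domain (§4.3) both provisos hold
for all large `n`, and LSW use the theorem only through the sentence "Theorem 4.4 implies that the
law of `W` converges weakly to the law of `B(8t)`" (proof of Thm. 4.7, p. 981), which is the named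
fact `drivingProcess_tendsto`. This theorem is that implication: if along every approximating
sequence, for every horizon `t̄` and `ε₂, ε₃ > 0`, eventually the law of the driving process `W`
under `ustLaw D^{Rₙ}` and the law of `t ↦ B(8t)` admit a coupling `ρ` with
`ρ[∃ t ≤ t̄, |W(t) - B(8t)| > ε₂] < ε₃`, then `drivingProcess_tendsto` holds — by the tree's
`Process.tendstoInDistribution_of_coupling` (Billingsley (1999), Thm. 3.1: couplings uniformly
close on compacts give convergence in distribution for the locally uniform topology) and the
portmanteau characterisation by bounded continuous test functions. So the debt carried by
`drivingProcess_tendsto` is exactly Thm. 4.4 as printed (plus `rad₀(D^{Rₙ}) → ∞` and the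
harmonic-measure proviso along approximations). [cite: LawlerSchrammWerner2004, Thm. 4.4] -/
theorem drivingProcess_tendsto_of_coupling
    (h : ∀ (D : SmoothDomain) (R : ℕ → ℝ) (Δ : ℕ → Domain), Tendsto R atTop atTop →
      (∀ n, IsApproximation D (R n) (Δ n)) → (∀ n, Nonempty (PeanoPath (Δ n))) →
        ∀ (φ : ∀ n, ConformalEquiv upperHalfPlaneSet (Δ n).carrier)
          (Γ : ∀ n, PeanoPath (Δ n) → C(ℝ≥0, ℂ)) (W : ∀ n, PeanoPath (Δ n) → C(ℝ≥0, ℝ)),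
          (∀ n, (Δ n).IsLSWMap (φ n) ∧ ∀ γ, IsCapacityImage (Δ n) (φ n) γ (Γ n γ) (W n γ)) →
            ∀ (T ε₂ ε₃ : ℝ), 0 < ε₂ → 0 < ε₃ → ∀ᶠ n in atTop,
              ∃ ρ : Measure (C(ℝ≥0, ℝ) × C(ℝ≥0, ℝ)), ρ.fst = (ustLaw (Δ n)).map (W n) ∧
                ρ.snd = Process.preWienerMeasure.map brownianTimeEight ∧
                ρ {p | ∃ t : ℝ≥0, (t : ℝ) ≤ T ∧ ε₂ < dist (p.1 t) (p.2 t)} < ENNReal.ofReal ε₃) :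
    drivingProcess_tendsto := by
  classical
  intro D R Δ hR hΔ hne φ Γ W hΓW f
  haveI : Fact Process.isProjectiveLimit_preWienerMeasure := ⟨isProjectiveLimit_preWienerMeasure_holds'⟩
  haveI : ∀ n, IsProbabilityMeasure (ustLaw (Δ n)) := fun n ↦ inferInstance
  have hWm : ∀ n, AEMeasurable (W n) (ustLaw (Δ n)) := fun n ↦
    (Measurable.of_discrete).aemeasurable
  have hBm : AEMeasurable brownianTimeEight Process.preWienerMeasure :=
    measurable_brownianTimeEight.aemeasurable
  -- the couplings give convergence in distribution on path space
  have hlaw : TendstoInDistribution W atTop brownianTimeEight (fun n ↦ ustLaw (Δ n))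
      Process.preWienerMeasure := by
    refine Process.tendstoInDistribution_of_coupling hWm hBm fun T ε hε η hη ↦ ?_
    have hsub : ∀ ρ : Measure (C(ℝ≥0, ℝ) × C(ℝ≥0, ℝ)),
        ρ {p | ∃ t : ℝ≥0, (t : ℝ) ≤ T ∧ ε ≤ dist (p.1 t) (p.2 t)} ≤
          ρ {p | ∃ t : ℝ≥0, (t : ℝ) ≤ T ∧ ε / 2 < dist (p.1 t) (p.2 t)} := fun ρ ↦ by
      refine measure_mono ?_
      rintro p ⟨t, ht, hd⟩
      exact ⟨t, ht, by linarith⟩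
    rcases eq_or_ne η ⊤ with rfl | hηtop
    · filter_upwards [h D R Δ hR hΔ hne φ Γ W hΓW T (ε / 2) 1 (half_pos hε) one_pos] with n hn
      obtain ⟨ρ, h1, h2, -⟩ := hn
      exact ⟨ρ, h1, h2, le_top⟩
    · have hη' : 0 < η.toReal := ENNReal.toReal_pos hη.ne' hηtop
      filter_upwards [h D R Δ hR hΔ hne φ Γ W hΓW T (ε / 2) η.toReal (half_pos hε) hη'] with n hn
      obtain ⟨ρ, h1, h2, h3⟩ := hn
      exact ⟨ρ, h1, h2, (hsub ρ).trans (h3.le.trans ENNReal.ofReal_toReal_le)⟩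
  -- portmanteau: bounded continuous test functions
  have key := hlaw.tendsto
  rw [ProbabilityMeasure.tendsto_iff_forall_integral_tendsto] at key
  have h1 : ∀ n, ∫ x, f x ∂((ustLaw (Δ n)).map (W n)) = ∫ γ, f (W n γ) ∂ustLaw (Δ n) := fun n ↦
    integral_map (hWm n) f.continuous.aestronglyMeasurable
  have h2 : ∫ x, f x ∂(Process.preWienerMeasure.map brownianTimeEight) =
      ∫ ω, f (brownianTimeEight ω) ∂Process.preWienerMeasure :=
    integral_map hBm f.continuous.aestronglyMeasurable
  have key' := key f
  simp only [ProbabilityMeasure.coe_mk, h1, h2] at key'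
  exact key'

end USTPeano

end Literature.Probability.RandomPlanarGeometry
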